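import Mathlib
import Literature.NumberTheory.EllipticCurves.HeegnerPointsKolyvaginStructure
import HarnessLib

/-!
# JetchevLauterSteinKolyvaginNonvanishing

Topic `Literature/NumberTheory/EllipticCurves`. Named literature fact(s) relocated by the gate from `Summits/BirchSwinnertonDyer/BirchSwinnertonDyer/Theorems/KolyvaginDepthDoorDepthTableJLSRows.lean`
(accept-time relocation of `[cite]`d propositions written inline in a Summits proposal; human ruling 2026-08-15).
Sources: JetchevLauterStein2009.

* `Literature.NumberTheory.EllipticCurves.JetchevLauterStein2009_kolyvaginClass_five_ne_zero_at_three`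
-/

namespace Literature.NumberTheory.EllipticCurves

open scoped Classical NumberField
open Literature.NumberTheory.EllipticCurves.ModularForms WeierstrassCurve

/-- **Jetchev–Lauter–Stein 2009, Prop. 3.10 and Remark 3.11 — three COMPUTED non-zero first derived
Kolyvagin classes at `p = 3` on rank-2 curves** (D. Jetchev, K. Lauter, W. Stein, J. Number Theory 129 (2009) 284–302 = arXiv:0707.0032,
§3.6; title in `references.bib`). Standing hypotheses of §3 (arXiv p. 6),
verbatim: *"Throughout the entire section we assume that `E_{/ℚ}` is an elliptic curve of conductor
`N`, `D` is a Heegner discriminant for `E` and `p ∤ ND` is a prime such that the mod `p` Galois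
representation `ρ̄_{E,p} : Gal(ℚ̄/ℚ) → Aut(E[p])` is surjective."* §3.1–3.2: Kolyvagin primes
(`ℓ` inert in `K = ℚ(√−D)`, `p ∣ a_ℓ`, `p ∣ ℓ + 1`), `P_c = Σ_{σ∈S} σ D_c y_c ∈ E(K[c])` over the ring
class field `K[c]`, and the classes `κ_{c,m} ∈ H¹(K, E[p^m])`, `m ≤ M(c)`, *"For the details of the
construction, we refer to [Gross 1991] and [McCallum 1991]"* (McCallum's cocycle, displayed).
§3.6 (arXiv p. 8), verbatim: *"Consider the example `E = 389A1` with equation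
`y² + y = x³ + x² − 2x`. As in Section 2.2, let `D = 7`, `ℓ = 5`, and `p = 3`. … Next, we observe
that `ℓ = 5` is a Kolyvagin prime for `E`, `p` and `D`. Let `c = 5` and consider the class
`κ_{5,1} ∈ H¹(K, E[3])`. … **Proposition 3.10.** The class `κ_{5,1} ≠ 0`. In other words,
Kolyvagin's [statement `T ≠ {0}`] holds for `E = 389A1`, `D = 7` and `p = 3`."* (proof: the degree-9 polynomial
`φ₃(x) − X(P₅)ψ₃(x)²` is irreducible over `K[5]`, so no `Q ∈ E(K[5])` has `3Q = P₅`); and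
*"**Remark 3.11.** Using exactly the same method as above, we verify Kolyvagin's [statement] for the
other two elliptic curves of rank two from Section 2.2. For both `E = 709A1` and `E = 718B1` we use
`D = 7`, `p = 3` and `ℓ = 5` (which are valid parameters), and verify that `κ_{5,1} ≠ 0` in the two
cases."* A PUBLISHED COMPUTATION (refereed), transcribed as a named fact like the tree's
`cremona_abs_maninConstant_eq_one_of_level_le`; it is NOT reproduced in the tree.
TRANSCRIPTION (vocabulary of `HeegnerPointsOfConductor`, the currency of
`Kolyvagin1991_selmerCorank_of_kolyvaginClass_ne_zero` and `BurungaleEtAl2026_exists_kolyvaginClass_ne_zero`):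
the three curves by Cremona's minimal equations `389a1 = [0,1,1,−2,0]` (the printed
`y² + y = x³ + x² − 2x`), `709a1 = [0,−1,1,−2,0]`, `718b1 = [1,0,1,−5,0]` pushed to `ℚ` (the tree's
handles of these curves, `KolyvaginDepthDoorDepthTableGlobalMinimal`); `K` ANY imaginary quadratic
field of discriminant `−7` (the printed `K = ℚ(√−7)`, unique up to isomorphism); CONCLUSION, per
curve: THERE EXIST a modular parametrisation datum `Dt` of level `N_E = W.conductorNorm ℤ` (the
authors' optimal parametrisation), an orientation `β`, an embedding `ι : K → ℂ` and a
Kolyvagin–Heegner datum `d` of conductor `5` (their `y₅`, `σ`, trivial `S` as `h_K = 1`) whose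
FIRST derived class at level `M = 1`, `c₁(5) = d.kolyvaginClass _ 1 ∈ H¹(K, E[3])` (McCallum's
cocycle class of `P₅`; never the junk value when non-zero, `KolyvaginHeegnerData.kolyvaginClass_ne_zero`)
is NON-ZERO. Weaker than print (existential over the normalisation the authors fixed); never
stronger. That `(3, −7, 5)` are admissible for these curves (`3 ∤ N·7`, `ρ̄_{E,3}` — indeed
`ρ̄_{E,3^m}` for all `m` — onto, `7` a Heegner discriminant, `5` a Kolyvagin prime with `M(5) = 1`)
is NOT part of the fact: it is PROVED in the kernel by its consumer
(`Summits/…/KolyvaginDepthDoorDepthTableJLSRows.lean`). Size: a finite machine computation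
(division polynomials over a degree-12 number field); no `_holds`.
[cite: JetchevLauterStein2009, §3.6 Prop. 3.10 and Remark 3.11 (arXiv:0707.0032 p. 8); §3 preamble and §3.1–3.2 (p. 6)]
[file NumberTheory/EllipticCurves/JetchevLauterSteinKolyvaginNonvanishing] -/
def JetchevLauterStein2009_kolyvaginClass_five_ne_zero_at_three : Prop :=
  (letI W : WeierstrassCurve ℚ := (⟨0, 1, 1, -2, 0⟩ : WeierstrassCurve ℤ).map (Int.castRingHom ℚ)
   ∀ [NeZero (W.conductorNorm ℤ)] (K : Type) [Field K] [NumberField K],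
     IsImaginaryQuadratic K → NumberField.discr K = -7 →
     ∃ (Dt : ModularParametrizationData W (W.conductorNorm ℤ)) (β : ℤ) (ι : K →+* ℂ)
       (d : KolyvaginHeegnerData Dt β ι 5), d.kolyvaginClass Nat.prime_three 1 ≠ 0) ∧
  (letI W : WeierstrassCurve ℚ := (⟨0, -1, 1, -2, 0⟩ : WeierstrassCurve ℤ).map (Int.castRingHom ℚ)
   ∀ [NeZero (W.conductorNorm ℤ)] (K : Type) [Field K] [NumberField K],
     IsImaginaryQuadratic K → NumberField.discr K = -7 →
     ∃ (Dt : ModularParametrizationData W (W.conductorNorm ℤ)) (β : ℤ) (ι : K →+* ℂ)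
       (d : KolyvaginHeegnerData Dt β ι 5), d.kolyvaginClass Nat.prime_three 1 ≠ 0) ∧
  (letI W : WeierstrassCurve ℚ := (⟨1, 0, 1, -5, 0⟩ : WeierstrassCurve ℤ).map (Int.castRingHom ℚ)
   ∀ [NeZero (W.conductorNorm ℤ)] (K : Type) [Field K] [NumberField K],
     IsImaginaryQuadratic K → NumberField.discr K = -7 →
     ∃ (Dt : ModularParametrizationData W (W.conductorNorm ℤ)) (β : ℤ) (ι : K →+* ℂ)
       (d : KolyvaginHeegnerData Dt β ι 5), d.kolyvaginClass Nat.prime_three 1 ≠ 0)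

end Literature.NumberTheory.EllipticCurves
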